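import Literature.Topology.FourManifolds.TrisectionsTriNormalForm
import Literature.Topology.FourManifolds.BoundaryGluingData
import Summits.SmoothPoincare4.SmoothPoincare4.Theorems.CongruenceShadowsAgkCor6SufficiencySpineDefs

/-!
# Tools for stub `stub_seamDiffeos` of line `lp-by-sphere-system-surgery` (crux `AgkCor6Sufficiency`,
item stmt-SmoothPoincare4-10894, routes CongruenceShadows / GroupTrisection; lead reshape r5, B2)

Generic lemmas for the construction of the three seam diffeomorphisms (`…StubSeamDiffeos.lean`),
bundled in the registered helper stub `stub_seamDiffeosToolsToolkit : SeamDiffeosToolsToolkit`: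

* `liftVia` — the lift of a point through an injection (with a default value), and its algebra;
* `contMDiffOn_of_embedding_comp` — a map into the source of a smooth embedding is smooth on a
  set as soon as its composite with the embedding is (the `ContMDiffWithinAt` lifting lemma
  `ContMDiffWithinAt.of_comp_isImmersionAt` of `BoundaryGluingData.lean`, pointwise);
* `TubeStructure.contMDiffWithinAt_tp` — the inverse `tp` of the product structure
  `Ξ = (ρ, u, v)` of a normal frame is jointly smooth in `(p, a, b)` along smooth data (read off
  the corner-slice chart formula of `TubeStructure.chart`);
* the seam algebra: in `U` the seam `H_m = S (m+1) ∩ S (m+2)` is the ray `{q_m = 0, p_m ≥ 0}`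
  (`TriNormalForm` wedges), and the radius of the ray point with parameter `p` lies between `p`
  and `√2 p`; points of `F` lie in every tube, `tp p 0 0 = p` on `F`.

References: Abrams–Gay–Kirby, Geom. Topol. 22 (2018), proof of Thm. 5 (the product neighbourhood
`F × D²` of the central surface); Gay–Kirby, Geom. Topol. 20 (2016), Def. 1.
-/

noncomputable section

-- the prescribed namespace `Summit.<P>.<Sub>.…` duplicates `SmoothPoincare4` (P = Sub)
set_option linter.dupNamespace false

namespace Summit.SmoothPoincare4.SmoothPoincare4.Cruxes.AgkCor6Sufficiency.LpBySphereSystemSurgery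

open Set Function Filter
open scoped _root_.Manifold _root_.ContDiff _root_.Topology
open Literature.Topology.FourManifolds

/-! ## Lifting points through an injection -/

section Lift

variable {α β : Type*}

open Classical in
/-- The lift of `y` through `f` (a preimage of `y` if there is one, the default `a` otherwise). -/
def liftVia (f : α → β) (a : α) (y : β) : α :=
  if h : ∃ z, f z = y then h.choose else a

/-- The lift of a point of the range is a preimage. -/
theorem apply_liftVia (f : α → β) (a : α) {y : β} (h : ∃ z, f z = y) : f (liftVia f a y) = y := by
  classical
  unfold liftVia
  rw [dif_pos h]
  exact h.choose_spec

/-- Through an injection, the lift of `f z` is `z`. -/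
theorem liftVia_apply {f : α → β} (hf : Injective f) (a z : α) : liftVia f a (f z) = z :=
  hf (apply_liftVia f a ⟨z, rfl⟩)

/-- Through an injection, the lift of `y = f z` is `z`. -/
theorem liftVia_eq {f : α → β} (hf : Injective f) (a : α) {y : β} {z : α} (h : f z = y) :
    liftVia f a y = z := by
  subst h
  exact liftVia_apply hf a z

end Lift

/-! ## Smoothness through a smooth embedding, within a set -/

section Embed

variable {EN : Type*} [NormedAddCommGroup EN] [NormedSpace ℝ EN] {HN : Type*} [TopologicalSpace HN]
  {IN : ModelWithCorners ℝ EN HN} {N : Type*} [TopologicalSpace N] [ChartedSpace HN N]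
  {EV : Type*} [NormedAddCommGroup EV] [NormedSpace ℝ EV] {HV : Type*} [TopologicalSpace HV]
  {IV : ModelWithCorners ℝ EV HV} {V : Type*} [TopologicalSpace V] [ChartedSpace HV V]
  {EW : Type*} [NormedAddCommGroup EW] [NormedSpace ℝ EW] {HW : Type*} [TopologicalSpace HW]
  {IW : ModelWithCorners ℝ EW HW} {W : Type*} [TopologicalSpace W] [ChartedSpace HW W]

/-- **A map into the source of a smooth embedding is smooth on a set as soon as, there, its
composite with the embedding agrees with a smooth map** (continuity within the set comes from
the topological embedding, smoothness from the immersion: the `Within` lifting lemma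
`ContMDiffWithinAt.of_comp_isImmersionAt`).  No openness of the set is required. -/
theorem contMDiffOn_of_embedding_comp [IsManifold IV ∞ V] [IsManifold IW ∞ W] {ι : V → W}
    (hι : Manifold.IsSmoothEmbedding IV IW ∞ ι) {e : N → V} {g : N → W} {s : Set N}
    (hg : ContMDiffOn IN IW ∞ g s) (heq : ∀ x ∈ s, ι (e x) = g x) : ContMDiffOn IN IV ∞ e s := by
  intro x hx
  have h1 : ContMDiffWithinAt IN IW ∞ (ι ∘ e) s x :=
    (hg x hx).congr (fun y hy => heq y hy) (heq x hx)
  have hc : ContinuousWithinAt e s x :=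
    hι.isEmbedding.isInducing.continuousWithinAt_iff.2 h1.continuousWithinAt
  exact ContMDiffWithinAt.of_comp_isImmersionAt (hι.isImmersion.isImmersionAt (e x)) hc h1

end Embed

/-! ## Joint smoothness of the inverse of the product structure -/

section Tube

variable {X : Type} [TopologicalSpace X] [ChartedSpace (EuclideanSpace ℝ (Fin 4)) X]

/-- The normal displacement vector `(a, b, 0, 0) ∈ ℝ⁴`. -/
def nrm2 (a b : ℝ) : EuclideanSpace ℝ (Fin 4) := !₂[a, b, 0, 0]

/-- The slice vector `(a, b, y₂, y₃)` is `stratumProj y + nrm2 a b`. -/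
theorem sliceVec_eq (a b : ℝ) (y : EuclideanSpace ℝ (Fin 4)) :
    (!₂[a, b, y 2, y 3] : EuclideanSpace ℝ (Fin 4)) = stratumProj y + nrm2 a b := by
  ext i; fin_cases i <;> simp [stratumProj, nrm2]

/-- `nrm2` is smooth (it is linear). -/
theorem contDiff_nrm2 : ContDiff ℝ ∞ (fun p : ℝ × ℝ => nrm2 p.1 p.2) := by
  rw [contDiff_euclidean]
  intro i
  fin_cases i
  · exact contDiff_fst
  · exact contDiff_snd
  · exact contDiff_const
  · exact contDiff_const

variable {EN : Type*} [NormedAddCommGroup EN] [NormedSpace ℝ EN] {HN : Type*} [TopologicalSpace HN]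
  {IN : ModelWithCorners ℝ EN HN} {N : Type*} [TopologicalSpace N] [ChartedSpace HN N]

/-- **`tp` is jointly smooth**: for a tube structure `(Ot, rt, tp)` of a normal frame and maps
`f : N → X`, `a b : N → ℝ`, smooth within `s` at `n₀ ∈ s`, with `f(s) ⊆ F` and
`a² + b² < rt²` on `s`, the map `n ↦ tp (f n) (a n) (b n)` is smooth within `s` at `n₀`
(near `n₀` it is the chart formula `Θ⁻¹ (stratumProj (Θ (f n)) + (a n, b n, 0, 0))` of
`TubeStructure.chart`). -/
theorem TubeStructure.contMDiffWithinAt_tp {S₀ F : Set X} {u v : X → ℝ} {ρ : X → X}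
    {O Ot : Set X} {rt : ℝ} {tp : X → ℝ → ℝ → X} (hTS : TubeStructure S₀ F u v ρ O Ot rt tp)
    {f : N → X} {a b : N → ℝ} {s : Set N} {n₀ : N}
    (hf : ContMDiffWithinAt IN (𝓡 4) ∞ f s n₀) (ha : ContMDiffWithinAt IN 𝓘(ℝ, ℝ) ∞ a s n₀)
    (hb : ContMDiffWithinAt IN 𝓘(ℝ, ℝ) ∞ b s n₀) (hn₀ : n₀ ∈ s) (hF : ∀ n ∈ s, f n ∈ F)
    (hab : ∀ n ∈ s, a n ^ 2 + b n ^ 2 < rt ^ 2) :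
    ContMDiffWithinAt IN (𝓡 4) ∞ (fun n => tp (f n) (a n) (b n)) s n₀ := by
  obtain ⟨C, W, hWo, hpW, hWs, -, hch⟩ := hTS.chart (f n₀) (hF n₀ hn₀)
  have hev : (fun n => tp (f n) (a n) (b n)) =ᶠ[𝓝[s] n₀]
      fun n => C.Θ.symm (stratumProj (C.Θ (f n)) + nrm2 (a n) (b n)) := by
    have h1 : f ⁻¹' W ∈ 𝓝[s] n₀ :=
      hf.continuousWithinAt.preimage_mem_nhdsWithin (hWo.mem_nhds hpW)
    filter_upwards [h1, self_mem_nhdsWithin] with n hn hns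
    rw [(hch (f n) hn (hF n hns) (a n) (b n) (hab n hns)).2, sliceVec_eq]
  have hsm : ContMDiffWithinAt IN (𝓡 4) ∞
      (fun n => C.Θ.symm (stratumProj (C.Θ (f n)) + nrm2 (a n) (b n))) s n₀ := by
    have hΘ : ContMDiffAt (𝓡 4) 𝓘(ℝ, EuclideanSpace ℝ (Fin 4)) ∞ C.Θ (f n₀) :=
      C.contMDiffOn_toFun.contMDiffAt (C.Θ.open_source.mem_nhds (hWs hpW))
    have h2 : ContMDiffWithinAt IN 𝓘(ℝ, EuclideanSpace ℝ (Fin 4)) ∞ (fun n => C.Θ (f n)) s n₀ :=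
      hΘ.comp_contMDiffWithinAt n₀ hf
    have h3 : ContMDiffWithinAt IN 𝓘(ℝ, EuclideanSpace ℝ (Fin 4)) ∞
        (fun n => stratumProj (C.Θ (f n))) s n₀ :=
      ((contMDiff_iff_contDiff.2 contDiff_stratumProj) _).comp_contMDiffWithinAt n₀ h2
    have h4 : ContMDiffWithinAt IN 𝓘(ℝ, EuclideanSpace ℝ (Fin 4)) ∞
        (fun n => nrm2 (a n) (b n)) s n₀ :=
      ((contMDiff_iff_contDiff.2 contDiff_nrm2) _).comp_contMDiffWithinAt n₀ (ha.prodMk_space hb)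
    have hy : stratumProj (C.Θ (f n₀)) + nrm2 (a n₀) (b n₀) ∈ C.Θ.target := by
      rw [← sliceVec_eq]
      exact (hch (f n₀) hpW (hF n₀ hn₀) (a n₀) (b n₀) (hab n₀ hn₀)).1
    have hΘs : ContMDiffAt 𝓘(ℝ, EuclideanSpace ℝ (Fin 4)) (𝓡 4) ∞ C.Θ.symm
        (stratumProj (C.Θ (f n₀)) + nrm2 (a n₀) (b n₀)) :=
      C.contMDiffOn_symm.contMDiffAt (C.Θ.open_target.mem_nhds hy)
    exact hΘs.comp_contMDiffWithinAt n₀ (h3.add h4)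
  refine hsm.congr_of_eventuallyEq hev ?_
  rw [(hch (f n₀) hpW (hF n₀ hn₀) (a n₀) (b n₀) (hab n₀ hn₀)).2, sliceVec_eq]

/-- **`tp` is jointly smooth on a set** (the `ContMDiffOn` form of
`TubeStructure.contMDiffWithinAt_tp`). -/
theorem TubeStructure.contMDiffOn_tp {S₀ F : Set X} {u v : X → ℝ} {ρ : X → X}
    {O Ot : Set X} {rt : ℝ} {tp : X → ℝ → ℝ → X} (hTS : TubeStructure S₀ F u v ρ O Ot rt tp)
    {f : N → X} {a b : N → ℝ} {s : Set N}
    (hf : ContMDiffOn IN (𝓡 4) ∞ f s) (ha : ContMDiffOn IN 𝓘(ℝ, ℝ) ∞ a s)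
    (hb : ContMDiffOn IN 𝓘(ℝ, ℝ) ∞ b s) (hF : ∀ n ∈ s, f n ∈ F)
    (hab : ∀ n ∈ s, a n ^ 2 + b n ^ 2 < rt ^ 2) :
    ContMDiffOn IN (𝓡 4) ∞ (fun n => tp (f n) (a n) (b n)) s := fun n hn =>
  hTS.contMDiffWithinAt_tp (hf n hn) (ha n hn) (hb n hn) hn hF hab

end Tube

/-! ## Seam algebra -/

section Seam

/-- `p_m` is a linear form in `(u, v)`. -/
theorem pCo_linear (m : Fin 3) : ∃ α β : ℝ, ∀ a b : ℝ, pCo m a b = α * a + β * b := by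
  fin_cases m
  · exact ⟨-1, 0, fun a b => by simp [pCo]⟩
  · exact ⟨1, 0, fun a b => by simp [pCo]⟩
  · exact ⟨0, 1, fun a b => by simp [pCo]⟩

/-- The ray of seam `m`: `(u, v) = (α p, β p)` with `1 ≤ α² + β² ≤ 2`. -/
theorem ray_linear (m : Fin 3) : ∃ α β : ℝ, (∀ p : ℝ, uOfPQ m p 0 = α * p ∧ vOfPQ m p 0 = β * p) ∧
    1 ≤ α ^ 2 + β ^ 2 ∧ α ^ 2 + β ^ 2 ≤ 2 := by
  fin_cases m
  · exact ⟨-1, -1, fun p => by simp [uOfPQ, vOfPQ], by norm_num, by norm_num⟩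
  · exact ⟨1, 0, fun p => by simp [uOfPQ, vOfPQ], by norm_num, by norm_num⟩
  · exact ⟨0, 1, fun p => by simp [uOfPQ, vOfPQ], by norm_num, by norm_num⟩

/-- The radius of the ray point with parameter `p`: `p² ≤ u² + v² ≤ 2 p²`. -/
theorem sq_ray (m : Fin 3) (p : ℝ) :
    p ^ 2 ≤ uOfPQ m p 0 ^ 2 + vOfPQ m p 0 ^ 2 ∧ uOfPQ m p 0 ^ 2 + vOfPQ m p 0 ^ 2 ≤ 2 * p ^ 2 := by
  obtain ⟨α, β, h, h1, h2⟩ := ray_linear m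
  rw [(h p).1, (h p).2]
  constructor <;> nlinarith [sq_nonneg p]

/-- On the ray (`q_m = 0`), `(u, v)` is recovered from `p_m`. -/
theorem uv_of_qCo_eq_zero (m : Fin 3) {a b : ℝ} (hq : qCo m a b = 0) :
    uOfPQ m (pCo m a b) 0 = a ∧ vOfPQ m (pCo m a b) 0 = b := by
  have hu := uOfPQ_pCo_qCo m a b
  have hv := vOfPQ_pCo_qCo m a b
  rw [hq] at hu hv
  exact ⟨hu, hv⟩

variable {X : Type} [TopologicalSpace X] [ChartedSpace (EuclideanSpace ℝ (Fin 4)) X]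
  {S : Fin 3 → Set X} {u v : X → ℝ} {ρ : X → X} {U O : Set X} {c : Fin 3 → ℕ → ℕ}

/-- **The seam `H_m = S (m+1) ∩ S (m+2)` in normal coordinates**: inside `U` it is the ray
`{q_m = 0, p_m ≥ 0}` (from the three wedges of a tri-normal form: `H₀ = S1 ∩ S2 = {u = v ≤ 0}`,
`H₁ = S2 ∩ S0 = {v = 0, u ≥ 0}`, `H₂ = S0 ∩ S1 = {u = 0, v ≥ 0}`). -/
theorem seam_iff (hT : TriNormalForm S 0 1 2 u v ρ U O c) (m : Fin 3) {y : X}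
    (hy : y ∈ U) : y ∈ S (m + 1) ∩ S (m + 2) ↔ qCo m (u y) (v y) = 0 ∧ 0 ≤ pCo m (u y) (v y) := by
  have h0 := hT.mem_i y hy
  have h1 := hT.mem_j y hy
  have h2 := hT.mem_l y hy
  fin_cases m
  · simp only [mem_inter_iff, qCo, pCo]
    simp
    rw [h1, h2]
    constructor
    · rintro ⟨⟨a1, a2⟩, a3, a4⟩; constructor <;> linarith
    · rintro ⟨a1, a2⟩; refine ⟨⟨?_, ?_⟩, ?_, ?_⟩ <;> linarith
  · simp only [mem_inter_iff, qCo, pCo]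
    simp
    rw [h2, h0]
    constructor
    · rintro ⟨⟨a1, a2⟩, a3, a4⟩; constructor <;> linarith
    · rintro ⟨a1, a2⟩; refine ⟨⟨?_, ?_⟩, ?_, ?_⟩ <;> linarith
  · simp only [mem_inter_iff, qCo, pCo]
    simp
    rw [h0, h1]
    constructor
    · rintro ⟨⟨a1, a2⟩, a3, a4⟩; constructor <;> linarith
    · rintro ⟨a1, a2⟩; refine ⟨⟨?_, ?_⟩, ?_, ?_⟩ <;> linarith

/-- A point of `F` lies in every tube `T(r)`, `r > 0` (`u = v = 0` on `F ⊆ Ot`). -/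
theorem TubeStructure.mem_tubeSet_of_mem_F {S₀ F : Set X} {Ot : Set X} {rt : ℝ}
    {tp : X → ℝ → ℝ → X} (hTS : TubeStructure S₀ F u v ρ O Ot rt tp)
    (hfr : NormalFrame F u v ρ U O) {p : X} (hp : p ∈ F) {r : ℝ} (hr : 0 < r) :
    p ∈ tubeSet Ot u v r := by
  obtain ⟨hu0, hv0⟩ := (hfr.memF_iff p (hfr.F_subset_U hp)).1 hp
  refine ⟨hTS.F_subset hp, ?_⟩
  rw [hu0, hv0]
  simpa using pow_pos hr 2

/-- `tp p 0 0 = p` for `p ∈ F`. -/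
theorem TubeStructure.tp_zero {S₀ F : Set X} {Ot : Set X} {rt : ℝ}
    {tp : X → ℝ → ℝ → X} (hTS : TubeStructure S₀ F u v ρ O Ot rt tp)
    (hfr : NormalFrame F u v ρ U O) {p : X} (hp : p ∈ F) : tp p 0 0 = p := by
  obtain ⟨hu0, hv0⟩ := (hfr.memF_iff p (hfr.F_subset_U hp)).1 hp
  have h := hTS.tp_self p (hTS.F_subset hp)
  rwa [hfr.ρ_eq_self_of_mem hp, hu0, hv0] at h

end Seam

/-! ## The registered helper stub -/

/-- **Toolkit of the seam diffeomorphisms, part 1** (registered helper stub of `stub_seamDiffeos`):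
the algebra of `liftVia`; smoothness through a smooth embedding within a set; the seam algebra
(`p_m` linear, `(u, v)` from `p_m` on the ray); points of `F` lie in all tubes and
`tp p 0 0 = p`; the seam `H_m` is the ray `{q_m = 0, p_m ≥ 0}` inside `U`, the radius bounds of
the ray; joint smoothness of `tp` on a set.  (A conjunction of statements PROVED in this file,
not a named fact.) -/
def SeamDiffeosToolsToolkit : Prop :=
  (∀ (α β : Type) (f : α → β), Injective f → ∀ (a z : α), liftVia f a (f z) = z) ∧
  (∀ (α β : Type) (f : α → β), Injective f → ∀ (a z : α) (y : β), f z = y → liftVia f a y = z) ∧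
  (∀ (EN : Type) [NormedAddCommGroup EN] [NormedSpace ℝ EN] (HN : Type) [TopologicalSpace HN]
    (IN : ModelWithCorners ℝ EN HN) (N : Type) [TopologicalSpace N] [ChartedSpace HN N]
    (EV : Type) [NormedAddCommGroup EV] [NormedSpace ℝ EV] (HV : Type) [TopologicalSpace HV]
    (IV : ModelWithCorners ℝ EV HV) (V : Type) [TopologicalSpace V] [ChartedSpace HV V]
    (EW : Type) [NormedAddCommGroup EW] [NormedSpace ℝ EW] (HW : Type) [TopologicalSpace HW]
    (IW : ModelWithCorners ℝ EW HW) (W : Type) [TopologicalSpace W] [ChartedSpace HW W]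
    [IsManifold IV ∞ V] [IsManifold IW ∞ W] (ι : V → W), Manifold.IsSmoothEmbedding IV IW ∞ ι →
    ∀ (e : N → V) (g : N → W) (s : Set N), ContMDiffOn IN IW ∞ g s → (∀ x ∈ s, ι (e x) = g x) →
    ContMDiffOn IN IV ∞ e s) ∧
  (∀ m : Fin 3, ∃ α β : ℝ, ∀ a b : ℝ, pCo m a b = α * a + β * b) ∧
  (∀ (m : Fin 3) (a b : ℝ), qCo m a b = 0 → uOfPQ m (pCo m a b) 0 = a ∧ vOfPQ m (pCo m a b) 0 = b) ∧
  (∀ (X : Type) [TopologicalSpace X] [ChartedSpace (EuclideanSpace ℝ (Fin 4)) X]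
    (S₀ F : Set X) (u v : X → ℝ) (ρ : X → X) (U O Ot : Set X) (rt : ℝ) (tp : X → ℝ → ℝ → X),
    TubeStructure S₀ F u v ρ O Ot rt tp → NormalFrame F u v ρ U O → ∀ p ∈ F,
    (∀ r : ℝ, 0 < r → p ∈ tubeSet Ot u v r) ∧ tp p 0 0 = p) ∧
  (∀ (X : Type) [TopologicalSpace X] [ChartedSpace (EuclideanSpace ℝ (Fin 4)) X]
    (S : Fin 3 → Set X) (u v : X → ℝ) (ρ : X → X) (U O : Set X) (c : Fin 3 → ℕ → ℕ),
    TriNormalForm S 0 1 2 u v ρ U O c → ∀ (m : Fin 3) (y : X), y ∈ U →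
      (y ∈ S (m + 1) ∩ S (m + 2) ↔ qCo m (u y) (v y) = 0 ∧ 0 ≤ pCo m (u y) (v y))) ∧
  (∀ (m : Fin 3) (p : ℝ), p ^ 2 ≤ uOfPQ m p 0 ^ 2 + vOfPQ m p 0 ^ 2 ∧
    uOfPQ m p 0 ^ 2 + vOfPQ m p 0 ^ 2 ≤ 2 * p ^ 2) ∧
  (∀ (X : Type) [TopologicalSpace X] [ChartedSpace (EuclideanSpace ℝ (Fin 4)) X]
    (S₀ F : Set X) (u v : X → ℝ) (ρ : X → X) (O Ot : Set X) (rt : ℝ) (tp : X → ℝ → ℝ → X),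
    TubeStructure S₀ F u v ρ O Ot rt tp →
    ∀ (N : Type) [TopologicalSpace N] [ChartedSpace (EuclideanSpace ℝ (Fin 4)) N]
      (f : N → X) (a b : N → ℝ) (s : Set N),
    ContMDiffOn (𝓡 4) (𝓡 4) ∞ f s → ContMDiffOn (𝓡 4) 𝓘(ℝ, ℝ) ∞ a s →
    ContMDiffOn (𝓡 4) 𝓘(ℝ, ℝ) ∞ b s → (∀ n ∈ s, f n ∈ F) → (∀ n ∈ s, a n ^ 2 + b n ^ 2 < rt ^ 2) →
    ContMDiffOn (𝓡 4) (𝓡 4) ∞ (fun n => tp (f n) (a n) (b n)) s)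

/-- **Registered helper stub `stub_seamDiffeosToolsToolkit`** of line `lp-by-sphere-system-surgery`
(toolkit, part 1, of the seam diffeomorphisms `stub_seamDiffeos`). -/
theorem stub_seamDiffeosToolsToolkit : SeamDiffeosToolsToolkit :=
  ⟨fun _ _ _ hf a z => liftVia_apply hf a z,
    fun _ _ _ hf a _ _ h => liftVia_eq hf a h,
    fun _ _ _ _ _ _ _ _ _ _ _ _ _ _ _ _ _ _ _ _ _ _ _ _ _ _ _ _ _ _ hι _ _ _ hg heq =>
      contMDiffOn_of_embedding_comp hι hg heq,
    pCo_linear,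
    fun m _ _ hq => uv_of_qCo_eq_zero m hq,
    fun _ _ _ _ _ _ _ _ _ _ _ _ _ hTS hfr _ hp =>
      ⟨fun _ hr => hTS.mem_tubeSet_of_mem_F hfr hp hr, hTS.tp_zero hfr hp⟩,
    fun _ _ _ _ _ _ _ _ _ _ hT m _ hy => seam_iff hT m hy,
    sq_ray,
    fun _ _ _ _ _ _ _ _ _ _ _ _ hTS _ _ _ _ _ _ _ hf ha hb hF hab => hTS.contMDiffOn_tp hf ha hb hF hab⟩

end Summit.SmoothPoincare4.SmoothPoincare4.Cruxes.AgkCor6Sufficiency.LpBySphereSystemSurgery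

end
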